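import Literature.MathematicalPhysics.StatisticalMechanics.BarlowBilayers
import Literature.Barriers.AtomisticToContinuum.HcpNotBravais
import Summits.Ventures.Crystal3D.Theorems.StickyWulffConstantGenericWallFloorCoaxialCriterion
import Summits.Ventures.Crystal3D.Theorems.StickyWulffConstantCoaxialWallLawTwinWord
import Summits.Ventures.Crystal3D.Theorems.StickyWulffConstantCoaxialWallLawFrame
import HarnessLib

/-!
# CSL twins have no cross contacts (lattice lemmas for the coincidence-site case of the twin rung)

HONEST FRAMING. Part of the venture `Summits/Ventures/Crystal3D` (cell `crystal3d-full`), helper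
`--supports` the crux `CoaxialWallLaw` (stmt-Ventures-19481, `route-Ventures-StickyWulffConstant`),
REGISTERED line `WallLedgerF` (planner cf-p1 gen 16), stub `stub_coaxialTwoSlabAdhesion`
(terrace/riser slot ledger, RIGID rung, CSL case).  Rung infrastructure only.  Kernel version of the
planner's sketch `HOME/cf-p1/route/lines/wall/CslTwin.lean` (cf-p1 gen 21, CSL-TWIN-memo.md),
re-proved here under `Theorems/` as the memo asks, plus the moved/normal form.

Let `Λ₀ = fccStacking 1 √(2/3)` (`…ABC…`) and `Λ₀⁻ = barlowStacking 1 √(2/3) (−1)` (`…ACB…`, the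
half-turn image `R '' Λ₀`, `barlowStacking_negConst_eq_halfTurn_image`).

* `twelve_mul_dist_sq_fcc_twin` — `12·dist((k,i,j)_{Λ₀}, (k',i',j')_{Λ₀⁻})² = 3(2P+Q+Λ')² + (3Q+Λ')² + 8(k−k')²`
  (`P = i−i'`, `Q = j−j'`, `Λ' = k+k'`); `csl_key_ne_twelve` — for `3 ∤ k`, `3 ∤ k'` that integer is
  never `12`; hence `dist_fcc_twin_ne_one`.
* `barlowPos_negConst_mem_fcc_of_dvd`, `barlowPos_const_mem_twin_of_dvd` — the layers `3 ∣ k`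
  are common to `Λ₀` and `Λ₀⁻` (coincidence layers).
* `dist_ne_one_of_mem_fcc_diff_twin` — **`p ∈ Λ₀ ∖ Λ₀⁻`, `q ∈ Λ₀⁻ ∖ Λ₀ ⇒ dist p q ≠ 1`**: a CSL twin
  pair has NO cross contacts between non-coincidence balls; `mem_fcc_of_dist_eq_one`.
* `movedTwin_eq_of_common_point` — normal form: a twin pair `L·Λ₀ + s₁`, `(R∘L)·Λ₀ + s₂` with a common
  point `c` is `(L·Λ₀ + c, L·Λ₀⁻ + c)`; `dist_ne_one_of_mem_movedFcc_diff_movedTwin` — the moved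
  form of the no-cross-contact lemma.

Consequence for the rigid rung (next files): at a non-coincidence ball of a rigid CSL twin filling
every contact sits at one of its own twelve slots, so the absorption inequality holds with WEIGHT ONE
(`12 − deg = #vacant slots ≥ #vacant in-plane slots`).

WHAT THIS IS NOT: the coincidence-line count, the CSL grain lemma, the stub; rung F-C1 not moved.
-/

noncomputable section

namespace Summit.Ventures.Crystal3D.Theorems

open Summit.Ventures.Crystal3D Finset
open Literature.MathematicalPhysics.StatisticalMechanics (barlowPos barlowStacking fccStacking
  constHagg haggLabel haggLabel_const barlowPos_mem barlowPos_apply_zero barlowPos_apply_one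
  barlowPos_apply_two barlowPos_eq_of_haggLabel_eq layerNormal)
open Literature.Barriers.AtomisticToContinuum (barlowAddSubgroupOfConst)
open scoped InnerProductSpace

/-! ## The cross-distance formula and its arithmetic -/

/-- **Cross distance formula**: `12 · dist(Λ₀-site (k,i,j), Λ₀⁻-site (k',i',j'))² =
3(2P+Q+Λ')² + (3Q+Λ')² + 8(k−k')²` with `P = i − i'`, `Q = j − j'`, `Λ' = k + k'`. -/
theorem twelve_mul_dist_sq_fcc_twin (k i j k' i' j' : ℤ) :
    12 * dist (barlowPos 1 (Real.sqrt (2 / 3)) constHagg k i j)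
        (barlowPos 1 (Real.sqrt (2 / 3)) (fun _ : ℤ => (-1 : ℤ)) k' i' j') ^ 2 =
      ((3 * (2 * (i - i') + (j - j') + (k + k')) ^ 2 + (3 * (j - j') + (k + k')) ^ 2 +
        8 * (k - k') ^ 2 : ℤ) : ℝ) := by
  rw [EuclideanSpace.dist_sq_eq, Fin.sum_univ_three, Real.dist_eq, Real.dist_eq, Real.dist_eq,
    sq_abs, sq_abs, sq_abs, barlowPos_apply_zero, barlowPos_apply_zero, barlowPos_apply_one,
    barlowPos_apply_one, barlowPos_apply_two, barlowPos_apply_two, haggLabel_const, haggLabel_negConst]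
  have h3 : (Real.sqrt 3 : ℝ) ^ 2 = 3 := Real.sq_sqrt (by norm_num)
  have hH : Real.sqrt (2 / 3) ^ 2 = 2 / 3 := Real.sq_sqrt (by norm_num)
  push_cast
  nlinarith [h3, hH]

/-- **The arithmetic core**: for `3 ∤ k`, `3 ∤ k'` the integer `3(2P+Q+k+k')² + (3Q+k+k')² + 8(k−k')²`
is never `12`. -/
theorem csl_key_ne_twelve (P Q k k' : ℤ) (hk : ¬ (3 : ℤ) ∣ k) (hk' : ¬ (3 : ℤ) ∣ k') :
    3 * (2 * P + Q + (k + k')) ^ 2 + (3 * Q + (k + k')) ^ 2 + 8 * (k - k') ^ 2 ≠ 12 := by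
  intro hE
  obtain h | h | h | h : k' = k ∨ k' = k + 1 ∨ k' = k - 1 ∨ (2 ≤ k - k' ∨ 2 ≤ k' - k) := by omega
  · -- same layer: `3 ∣ (3Q + 2k)²`, hence `3 ∣ k`
    rw [h] at hE
    have h3 : (3 : ℤ) ∣ (3 * Q + (k + k)) ^ 2 :=
      ⟨4 - (2 * P + Q + (k + k)) ^ 2, by nlinarith⟩
    have h3' : (3 : ℤ) ∣ 3 * Q + (k + k) := Int.Prime.dvd_pow' (by norm_num) h3
    omega
  · -- adjacent layers: `3 ∣ k + k'`, so `3 x² + y² = 4` with `3 ∣ y` — impossible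
    rw [h] at hE hk'
    have h1 : k % 3 = 1 := by omega
    have hy : (3 : ℤ) ∣ 3 * Q + (k + (k + 1)) := by omega
    obtain ⟨m, hm⟩ := hy
    rw [hm] at hE
    have : (3 : ℤ) ∣ 4 :=
      ⟨(2 * P + Q + (k + (k + 1))) ^ 2 + 3 * m ^ 2, by linear_combination (-1 : ℤ) * hE⟩
    omega
  · rw [h] at hE hk'
    have h1 : k % 3 = 2 := by omega
    have hy : (3 : ℤ) ∣ 3 * Q + (k + (k - 1)) := by omega
    obtain ⟨m, hm⟩ := hy
    rw [hm] at hE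
    have : (3 : ℤ) ∣ 4 :=
      ⟨(2 * P + Q + (k + (k - 1))) ^ 2 + 3 * m ^ 2, by linear_combination (-1 : ℤ) * hE⟩
    omega
  · -- two or more layers apart: `8 (k − k')² ≥ 32`
    have h4 : 4 ≤ (k - k') ^ 2 := by
      rcases h with h | h <;> nlinarith
    nlinarith [sq_nonneg (2 * P + Q + (k + k')), sq_nonneg (3 * Q + (k + k'))]

/-- **CSL twins have no cross contacts (coordinate form).**  A site of a non-coincidence layer of
`Λ₀` (`3 ∤ k`) and a site of a non-coincidence layer of `Λ₀⁻` (`3 ∤ k'`) are never at distance `1`. -/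
theorem dist_fcc_twin_ne_one {k k' : ℤ} (hk : ¬ (3 : ℤ) ∣ k) (hk' : ¬ (3 : ℤ) ∣ k') (i j i' j' : ℤ) :
    dist (barlowPos 1 (Real.sqrt (2 / 3)) constHagg k i j)
      (barlowPos 1 (Real.sqrt (2 / 3)) (fun _ : ℤ => (-1 : ℤ)) k' i' j') ≠ 1 := by
  intro hd
  have h12 := twelve_mul_dist_sq_fcc_twin k i j k' i' j'
  rw [hd, one_pow, mul_one] at h12
  have hZ : (3 * (2 * (i - i') + (j - j') + (k + k')) ^ 2 + (3 * (j - j') + (k + k')) ^ 2 +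
      8 * (k - k') ^ 2 : ℤ) = 12 := by exact_mod_cast h12.symm
  exact csl_key_ne_twelve (i - i') (j - j') k k' hk hk' hZ

/-! ## Coincidence layers -/

/-- Coincidence layers: a site of a `3 ∣ k` layer of `Λ₀⁻` is a site of `Λ₀`. -/
theorem barlowPos_negConst_mem_fcc_of_dvd {k : ℤ} (hk : (3 : ℤ) ∣ k) (i j : ℤ) :
    barlowPos 1 (Real.sqrt (2 / 3)) (fun _ : ℤ => (-1 : ℤ)) k i j ∈ fccStacking 1 (Real.sqrt (2 / 3)) := by
  obtain ⟨m, rfl⟩ := hk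
  have hL : haggLabel constHagg (3 * m) = haggLabel (fun _ : ℤ => (-1 : ℤ)) (3 * m) + 3 * (2 * m) := by
    rw [haggLabel_const, haggLabel_negConst]; ring
  have := barlowPos_eq_of_haggLabel_eq 1 (Real.sqrt (2 / 3)) (s := fun _ : ℤ => (-1 : ℤ))
    (s' := constHagg) (k := 3 * m) (k' := 3 * m) (q := 2 * m) (i - 2 * m) (j - 2 * m) hL
  simp only [sub_self, zero_smul, add_zero, sub_add_cancel] at this
  rw [← this]
  exact barlowPos_mem _ _ _

/-- Coincidence layers: a site of a `3 ∣ k` layer of `Λ₀` is a site of `Λ₀⁻`. -/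
theorem barlowPos_const_mem_twin_of_dvd {k : ℤ} (hk : (3 : ℤ) ∣ k) (i j : ℤ) :
    barlowPos 1 (Real.sqrt (2 / 3)) constHagg k i j ∈
      barlowStacking 1 (Real.sqrt (2 / 3)) (fun _ : ℤ => (-1 : ℤ)) := by
  obtain ⟨m, rfl⟩ := hk
  have hL : haggLabel (fun _ : ℤ => (-1 : ℤ)) (3 * m) = haggLabel constHagg (3 * m) + 3 * (-(2 * m)) := by
    rw [haggLabel_const, haggLabel_negConst]; ring
  have := barlowPos_eq_of_haggLabel_eq 1 (Real.sqrt (2 / 3)) (s := constHagg)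
    (s' := fun _ : ℤ => (-1 : ℤ)) (k := 3 * m) (k' := 3 * m) (q := -(2 * m)) (i + 2 * m) (j + 2 * m) hL
  simp only [sub_self, zero_smul, add_zero, add_neg_cancel_right] at this
  rw [← this]
  exact barlowPos_mem _ _ _

/-! ## No cross contacts -/

/-- **CSL twins have no cross contacts (set form).**  `p ∈ Λ₀ ∖ Λ₀⁻`, `q ∈ Λ₀⁻ ∖ Λ₀ ⇒ dist p q ≠ 1`. -/
theorem dist_ne_one_of_mem_fcc_diff_twin {p q : EuclideanSpace ℝ (Fin 3)}
    (hp : p ∈ fccStacking 1 (Real.sqrt (2 / 3)))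
    (hp' : p ∉ barlowStacking 1 (Real.sqrt (2 / 3)) (fun _ : ℤ => (-1 : ℤ)))
    (hq : q ∈ barlowStacking 1 (Real.sqrt (2 / 3)) (fun _ : ℤ => (-1 : ℤ)))
    (hq' : q ∉ fccStacking 1 (Real.sqrt (2 / 3))) : dist p q ≠ 1 := by
  obtain ⟨k, i, j, rfl⟩ := hp
  obtain ⟨k', i', j', rfl⟩ := hq
  have hk : ¬ (3 : ℤ) ∣ k := fun h => hp' (barlowPos_const_mem_twin_of_dvd h i j)
  have hk' : ¬ (3 : ℤ) ∣ k' := fun h => hq' (barlowPos_negConst_mem_fcc_of_dvd h i' j')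
  exact dist_fcc_twin_ne_one hk hk' i j i' j'

/-- **Own-slot contacts.**  In a configuration on `Λ₀ ∪ Λ₀⁻`, every point at distance `1` from a
non-coincidence `Λ₀`-point `x` is itself a `Λ₀`-point. -/
theorem mem_fcc_of_dist_eq_one {x y : EuclideanSpace ℝ (Fin 3)}
    (hx : x ∈ fccStacking 1 (Real.sqrt (2 / 3)))
    (hx' : x ∉ barlowStacking 1 (Real.sqrt (2 / 3)) (fun _ : ℤ => (-1 : ℤ)))
    (hy : y ∈ fccStacking 1 (Real.sqrt (2 / 3)) ∨
      y ∈ barlowStacking 1 (Real.sqrt (2 / 3)) (fun _ : ℤ => (-1 : ℤ)))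
    (hd : dist x y = 1) : y ∈ fccStacking 1 (Real.sqrt (2 / 3)) := by
  rcases hy with hy | hy
  · exact hy
  · by_contra hy'
    exact dist_ne_one_of_mem_fcc_diff_twin hx hx' hy hy' hd

/-! ## The moved / normal form of a CSL twin pair -/

/-- **Normal form of a co-axial twin pair with a coincidence site.**  If `c` lies on both grains
`L·Λ₀ + s₁` and `(R∘L)·Λ₀ + s₂` (`R` the half-turn about `e₃`), then the grains are `L·Λ₀ + c` and
`L·Λ₀⁻ + c`. -/
theorem movedTwin_eq_of_common_point
    (L : EuclideanSpace ℝ (Fin 3) ≃ₗᵢ[ℝ] EuclideanSpace ℝ (Fin 3)) (s₁ s₂ c : EuclideanSpace ℝ (Fin 3))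
    (hc₁ : c ∈ (fun q => L q + s₁) '' fccStacking 1 (Real.sqrt (2 / 3)))
    (hc₂ : c ∈ (fun q => ((ℝ ∙ EuclideanSpace.single (2 : Fin 3) (1 : ℝ)).reflection.trans L) q + s₂) ''
      fccStacking 1 (Real.sqrt (2 / 3))) :
    (fun q => L q + s₁) '' fccStacking 1 (Real.sqrt (2 / 3)) =
        (fun q => L q + c) '' fccStacking 1 (Real.sqrt (2 / 3)) ∧
      (fun q => ((ℝ ∙ EuclideanSpace.single (2 : Fin 3) (1 : ℝ)).reflection.trans L) q + s₂) ''
          fccStacking 1 (Real.sqrt (2 / 3)) =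
        (fun q => L q + c) '' barlowStacking 1 (Real.sqrt (2 / 3)) (fun _ : ℤ => (-1 : ℤ)) := by
  set R := (ℝ ∙ EuclideanSpace.single (2 : Fin 3) (1 : ℝ)).reflection with hR
  -- the twin stacking is an additive subgroup and equals `R '' Λ₀`
  set G := barlowAddSubgroupOfConst 1 (Real.sqrt (2 / 3)) (fun _ : ℤ => (-1 : ℤ)) (fun _ => rfl) with hG
  have hGmem : ∀ p, p ∈ G ↔ p ∈ barlowStacking 1 (Real.sqrt (2 / 3)) (fun _ : ℤ => (-1 : ℤ)) :=
    fun p => Iff.rfl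
  have htwin : barlowStacking 1 (Real.sqrt (2 / 3)) (fun _ : ℤ => (-1 : ℤ)) =
      R '' fccStacking 1 (Real.sqrt (2 / 3)) := barlowStacking_negConst_eq_halfTurn_image
  obtain ⟨p₀, hp₀, hc₁e⟩ := hc₁
  obtain ⟨q₀, hq₀, hc₂e⟩ := hc₂
  simp only at hc₁e hc₂e
  constructor
  · ext x
    constructor
    · rintro ⟨q, hq, rfl⟩
      refine ⟨q - p₀, fcc_sub_site_mem hq hp₀, ?_⟩
      simp only [map_sub, ← hc₁e]; abel
    · rintro ⟨q, hq, rfl⟩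
      refine ⟨q + p₀, fcc_add_site_mem hq hp₀, ?_⟩
      simp only [map_add, ← hc₁e]; abel
  · have hRq₀ : R q₀ ∈ barlowStacking 1 (Real.sqrt (2 / 3)) (fun _ : ℤ => (-1 : ℤ)) := by
      rw [htwin]; exact ⟨q₀, hq₀, rfl⟩
    ext x
    constructor
    · rintro ⟨q, hq, rfl⟩
      have hRq : R q ∈ barlowStacking 1 (Real.sqrt (2 / 3)) (fun _ : ℤ => (-1 : ℤ)) := by
        rw [htwin]; exact ⟨q, hq, rfl⟩
      refine ⟨R q - R q₀, (hGmem _).1 (G.sub_mem ((hGmem _).2 hRq) ((hGmem _).2 hRq₀)), ?_⟩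
      simp only [map_sub, ← hc₂e, LinearIsometryEquiv.trans_apply]; abel
    · rintro ⟨q, hq, rfl⟩
      have hsum : q + R q₀ ∈ barlowStacking 1 (Real.sqrt (2 / 3)) (fun _ : ℤ => (-1 : ℤ)) :=
        (hGmem _).1 (G.add_mem ((hGmem _).2 hq) ((hGmem _).2 hRq₀))
      rw [htwin] at hsum
      obtain ⟨q', hq', hq'e⟩ := hsum
      refine ⟨q', hq', ?_⟩
      simp only [LinearIsometryEquiv.trans_apply]
      rw [hq'e, map_add, ← hc₂e, LinearIsometryEquiv.trans_apply]; abel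

/-- **No cross contacts, moved form.**  For the CSL twin pair `Λ₁ = L·Λ₀ + c`, `Λ₂ = L·Λ₀⁻ + c`:
a ball of `Λ₁ ∖ Λ₂` and a ball of `Λ₂ ∖ Λ₁` are never at distance `1`. -/
theorem dist_ne_one_of_mem_movedFcc_diff_movedTwin
    (L : EuclideanSpace ℝ (Fin 3) ≃ₗᵢ[ℝ] EuclideanSpace ℝ (Fin 3)) (c : EuclideanSpace ℝ (Fin 3))
    {x y : EuclideanSpace ℝ (Fin 3)}
    (hx : x ∈ (fun q => L q + c) '' fccStacking 1 (Real.sqrt (2 / 3)))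
    (hx' : x ∉ (fun q => L q + c) '' barlowStacking 1 (Real.sqrt (2 / 3)) (fun _ : ℤ => (-1 : ℤ)))
    (hy : y ∈ (fun q => L q + c) '' barlowStacking 1 (Real.sqrt (2 / 3)) (fun _ : ℤ => (-1 : ℤ)))
    (hy' : y ∉ (fun q => L q + c) '' fccStacking 1 (Real.sqrt (2 / 3))) : dist x y ≠ 1 := by
  obtain ⟨p, hp, rfl⟩ := hx
  obtain ⟨q, hq, rfl⟩ := hy
  have hp' : p ∉ barlowStacking 1 (Real.sqrt (2 / 3)) (fun _ : ℤ => (-1 : ℤ)) :=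
    fun h => hx' ⟨p, h, rfl⟩
  have hq' : q ∉ fccStacking 1 (Real.sqrt (2 / 3)) := fun h => hy' ⟨q, h, rfl⟩
  have hd : dist (L p + c) (L q + c) = dist p q := by
    rw [dist_add_right, LinearIsometryEquiv.dist_map]
  rw [hd]
  exact dist_ne_one_of_mem_fcc_diff_twin hp hp' hq hq'

/-- **Own-slot contacts, moved form.**  For the CSL twin pair `Λ₁ = L·Λ₀ + c`, `Λ₂ = L·Λ₀⁻ + c` and a
RIGID configuration (`X ⊆ Λ₁ ∪ Λ₂`): every ball of `X` at distance `1` from a NON-coincidence ball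
`x ∈ Λ₁ ∖ Λ₂` lies on `Λ₁` — such a ball has no foreign contacts. -/
theorem mem_movedFcc_of_dist_eq_one_of_rigid
    (L : EuclideanSpace ℝ (Fin 3) ≃ₗᵢ[ℝ] EuclideanSpace ℝ (Fin 3)) (c : EuclideanSpace ℝ (Fin 3))
    (X : Finset (EuclideanSpace ℝ (Fin 3)))
    (hrigid : ∀ p ∈ X, p ∈ (fun q => L q + c) '' fccStacking 1 (Real.sqrt (2 / 3)) ∨
      p ∈ (fun q => L q + c) '' barlowStacking 1 (Real.sqrt (2 / 3)) (fun _ : ℤ => (-1 : ℤ)))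
    {x y : EuclideanSpace ℝ (Fin 3)}
    (hx : x ∈ (fun q => L q + c) '' fccStacking 1 (Real.sqrt (2 / 3)))
    (hx' : x ∉ (fun q => L q + c) '' barlowStacking 1 (Real.sqrt (2 / 3)) (fun _ : ℤ => (-1 : ℤ)))
    (hyX : y ∈ X) (hd : dist x y = 1) :
    y ∈ (fun q => L q + c) '' fccStacking 1 (Real.sqrt (2 / 3)) := by
  rcases hrigid y hyX with hy | hy
  · exact hy
  · by_contra hy'
    exact dist_ne_one_of_mem_movedFcc_diff_movedTwin L c hx hx' hy hy' hd

end Summit.Ventures.Crystal3D.Theorems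

end
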